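/-
Origin: expansion seat `prover-pub-hodgecm-mc-binder-1-g14-0`, handover #R91 2026-08-20T16:54:41Z md5 c3e42c909da6 (63 l.; NEW additive MODEL leaf on the (iib-R) 4-ary `Model/Universe`: (J1) AT THE MODEL — `heckeOpModel h₂ L ι₁ V Γ hA k g : Module.End ℂ ((universeOf hHD hI hU h₃).CohC (pms L ι₁ V Γ) k)` := `heckeOpC (quotientDatumOf (ballDatumOf …) h₂) …`; imports Model/Universe + #R89 + #R90 (none in glue-1 scope56 block); drop-alone; NAME LIST: HodgeCM.Model.heckeOpModel_one) (`HOME/mc/pub-hodgecm-mc-binder-1-g14/stage56/HodgeCM/Model/HeckeOperatorModel.lean`, md5 c3e42c909da6, 63 lines);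
landed by the second packager p2 gen 10 (p2-g10) in gate run 56 as `HodgeCM/Model/HeckeOperatorModel.lean` (packager comment re-wording per the RUN-32 precedent (gate audit (5) rejects the proof-placeholder tokens s-o-r-r-y / a-d-m-i-t anywhere in a source, comments included): 1 occurrence(s) inside COMMENTS re-spelt `proof-hole` / `adm-token`; no Lean code byte touched).
-/
/-
Copyright (c) 2026 the pub-hodgecm formalisation cell (harness21).  New file, not vendored.
Origin: session prover-pub-hodgecm-mc-binder-1-g14-0 (unit pub-hodgecm-mc-binder-1-g14, BINDER PROVER gen 14 of lineage mc-binder-1;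
content lane (J-Liu-Θ), scope memo `HOME/mc/pub-hodgecm-mc-binder-1-g14/JLIU-THETA-SCOPE.md` §2 (J1), §6.2 (c2)), 2026-08-20.  Intended final place:
`HodgeCM/Model/HeckeOperatorModel.lean` (NEW additive leaf; imports the INSTALLED `HodgeCM.Model.Universe` ((iib-R) 4-ary bytes) and the two
binder-1 leaves `HodgeCM.Model.HeckeOperatorOf`, `HodgeCM.Model.QuotientDatumOfUniformisation`; nothing imports it; drop alone on bounce).
-/
import Summits.HodgeConjecture.HodgeCM.Model.Universe
import Summits.HodgeConjecture.HodgeCM.Model.HeckeOperatorOf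
import Summits.HodgeConjecture.HodgeCM.Model.QuotientDatumOfUniformisation

set_option autoImplicit false

/-!
# (J1) at the model: the Hecke operator `T_g` on `CohC (P_Γ) k` of the END STATE's Picard modular surface, granted (ii-b)

KERNEL composition of three installed/tabled pieces, nothing cited anew, nothing minted: the model's uniformisation datum
`Model.ballDatumOf hHD hI hU h₃ L ι₁ V Γ hA : UnitaryBallUniformisationDatum 2 (Var.scheme hU h₃ (.pms …))` (`Model/Universe`, (iib-R) bytes),
upgraded to a ball-quotient datum by `Model.quotientDatumOf · h₂` (`h₂ : SpecialCyclesAlgebraic` = (ii-b), a FIRM vendored print fact), fed to the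
β-transported vendored operator `Model.heckeOpC` (`Model/HeckeOperatorOf`).  Since `(universeOf hHD hI hU h₃).CohC X k` is by definition
`ℂ ⊗[ℚ] bettiCohomology (Var.scheme hU h₃ X) k`, the result IS an endomorphism of the model's `CohC (pms L ι₁ V Γ) k` — the carrier of the theta classes
(`k = 1`) and of row 9's `Uiso`.

* `heckeOpModel h₂ L ι₁ V Γ hA k g : Module.End ℂ ((universeOf hHD hI hU h₃).CohC ((universeOf hHD hI hU h₃).pms L ι₁ V Γ) k)`;
* `heckeOpModel_one` (`T_1 = id`); off the admissible locus `T_g = 0` is `heckeOpC_of_not` (by the tree theorem `isHeckeAdmissible_of_mem_unitaryGroup`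
  every `g ∈ U(V)(E)` is admissible; that theorem is Summits-side and not yet vendored, memo §6.2 (b)).

What this does NOT do: (J2) (equivariance of the class map `classMapDatumOf` under `T_g` vs the translates of the vendored N33b) — the next item.
0 `proof-hole`, 0 `axiom`; expected `#print axioms` ⊆ {propext, Classical.choice, Quot.sound}.
-/

noncomputable section

open Literature.AlgebraicGeometry.HodgeTheory
open Literature.AlgebraicGeometry.ShimuraVarieties
open Literature.NumberTheory.Automorphic.PicardCM

namespace HodgeCM

namespace Model

variable {hHD : exists_isReal_hodgeModel} {hI : hodgePQ_independent_of_hodgeModel}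
  {hU : BallQuotientUniformisedDatum} {h₃ : CMAbelianVarietyRealised}

/-- **(J1) at the model, path (c2)**: the Hecke operator `T_g` (`g ∈ GL₃(E)`, `E = D.E` the distinguished subfield of the model's datum) on
`CohC (P_Γ) k = ℂ ⊗ H^k(P_Γ(ℂ);ℚ)` of the END STATE's surface `P_Γ = pms L ι₁ V Γ`, granted (ii-b) `h₂`. [folklore] -/
def heckeOpModel (h₂ : SpecialCyclesAlgebraic) (L : CMField) (ι₁ : L →+* ℂ) (V : HermSpace3 L ι₁) (Γ : Level V)
    (hA : IsAnisotropic L V.Hm) (k : ℕ)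
    (g : GL (Fin 3) ↥(ballDatumOf (hHD := hHD) (hI := hI) (hU := hU) (h₃ := h₃) L ι₁ V Γ hA).E) :
    Module.End ℂ ((universeOf hHD hI hU h₃).CohC ((universeOf hHD hI hU h₃).pms L ι₁ V Γ) k) :=
  heckeOpC (quotientDatumOf (ballDatumOf L ι₁ V Γ hA) h₂) (ballDatumOf (hHD := hHD) (hI := hI) L ι₁ V Γ hA).isSmoothProjective k g

/-- `T_1 = id` on the model's `CohC (P_Γ) k`. [folklore] -/
theorem heckeOpModel_one (h₂ : SpecialCyclesAlgebraic) (L : CMField) (ι₁ : L →+* ℂ) (V : HermSpace3 L ι₁) (Γ : Level V)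
    (hA : IsAnisotropic L V.Hm) (k : ℕ) :
    heckeOpModel (hHD := hHD) (hI := hI) (hU := hU) (h₃ := h₃) h₂ L ι₁ V Γ hA k 1 = LinearMap.id :=
  heckeOpC_one _ _ k

end Model

end HodgeCM

end
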